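import Mathlib
import HarnessLib
import Summits.AtomisticToContinuum.Crystallization.Theorems.PricedLinkCensusSoftFourRingsPosition

/-!
# Soft four-rings: three slack triangles are impossible

Support file for `SoftFourRings` (route `PricedLinkCensus`, sub-problem `Crystallization`).
Bond-set level, three blocks (the conclusions of `slack_block` without the bond-triangle counts)
and the set `N0` of the three vertices outside the slack triangles.

* `three_blocks_u` : the fan vertex `u₁` is not in `N0` (double counting of the bonds between
  `N0` and the nine triangle vertices: `≤ 12` from the `N0` side, `≥ 13` otherwise);
* `no_three_blocks` : three blocks are impossible (the apex `r₁` lies in another triangle, whose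
  vertices all have a partner in `N0`, while `N(r₁) = {u₁, a₁, b₁, u'₁}` avoids `N0`).
-/

namespace Summit.AtomisticToContinuum.Crystallization.Theorems

open Real RealInnerProductSpace Literature.Geometry.DiscreteGeometry

section Setting

variable {X : Finset (EuclideanSpace ℝ (Fin 3))} {B : Finset (Finset (EuclideanSpace ℝ (Fin 3)))}
  (hB : ∀ T ∈ B, ∃ u ∈ X, ∃ u' ∈ X, u ≠ u' ∧ 1 - (101 / 100 : ℝ) ^ 2 / 2 ≤ ⟪u, u'⟫ ∧ T = {u, u'})
  (hdeg : ∀ v ∈ X, ∃ w : Fin 4 → EuclideanSpace ℝ (Fin 3), (∀ k, w k ∈ X) ∧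
    Function.Injective w ∧ (∀ k, w k ≠ v) ∧
    (∀ k, ({v, w k} : Finset (EuclideanSpace ℝ (Fin 3))) ∈ B) ∧
    ∀ y, ({v, y} : Finset (EuclideanSpace ℝ (Fin 3))) ∈ B → ∃ k, y = w k)

include hdeg in
/-- With three blocks, the fan vertex `u₁` is not one of the three vertices of `N0`. -/
theorem three_blocks_u {a1 b1 c1 p1 q1 u1 w1 m1 n1 r1 a2 b2 c2 p2 q2 u2 w2 m2 n2 r2 a3 b3 c3 p3 q3 u3 w3 m3 n3 r3 :
      EuclideanSpace ℝ (Fin 3)}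
    (h1 : ((p1 ∈ X ∧ q1 ∈ X ∧ u1 ∈ X ∧ w1 ∈ X ∧ m1 ∈ X ∧ n1 ∈ X ∧ r1 ∈ X) ∧
      (∀ y, ({a1, y} : Finset (EuclideanSpace ℝ (Fin 3))) ∈ B ↔ (y = p1 ∨ y = u1 ∨ y = r1 ∨ y = b1)) ∧
      (∀ y, ({b1, y} : Finset (EuclideanSpace ℝ (Fin 3))) ∈ B ↔ (y = q1 ∨ y = w1 ∨ y = r1 ∨ y = a1)) ∧
      (∀ y, ({c1, y} : Finset (EuclideanSpace ℝ (Fin 3))) ∈ B ↔ (y = p1 ∨ y = n1 ∨ y = m1 ∨ y = q1)) ∧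
      (∀ y, ({r1, y} : Finset (EuclideanSpace ℝ (Fin 3))) ∈ B ↔ (y = u1 ∨ y = a1 ∨ y = b1 ∨ y = w1)) ∧
      (({p1, u1} : Finset (EuclideanSpace ℝ (Fin 3))) ∈ B ∧
        ({u1, r1} : Finset (EuclideanSpace ℝ (Fin 3))) ∈ B ∧
        ({r1, b1} : Finset (EuclideanSpace ℝ (Fin 3))) ∈ B ∧
        ({q1, w1} : Finset (EuclideanSpace ℝ (Fin 3))) ∈ B ∧
        ({w1, r1} : Finset (EuclideanSpace ℝ (Fin 3))) ∈ B ∧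
        ({p1, n1} : Finset (EuclideanSpace ℝ (Fin 3))) ∈ B ∧
        ({n1, m1} : Finset (EuclideanSpace ℝ (Fin 3))) ∈ B ∧
        ({m1, q1} : Finset (EuclideanSpace ℝ (Fin 3))) ∈ B) ∧
      (({p1, r1} : Finset (EuclideanSpace ℝ (Fin 3))) ∉ B ∧
        ({u1, b1} : Finset (EuclideanSpace ℝ (Fin 3))) ∉ B ∧
        ({p1, b1} : Finset (EuclideanSpace ℝ (Fin 3))) ∉ B ∧
        ({q1, r1} : Finset (EuclideanSpace ℝ (Fin 3))) ∉ B ∧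
        ({w1, a1} : Finset (EuclideanSpace ℝ (Fin 3))) ∉ B ∧
        ({q1, a1} : Finset (EuclideanSpace ℝ (Fin 3))) ∉ B ∧
        ({p1, m1} : Finset (EuclideanSpace ℝ (Fin 3))) ∉ B ∧
        ({n1, q1} : Finset (EuclideanSpace ℝ (Fin 3))) ∉ B ∧
        ({p1, q1} : Finset (EuclideanSpace ℝ (Fin 3))) ∉ B ∧
        ({u1, w1} : Finset (EuclideanSpace ℝ (Fin 3))) ∉ B) ∧
      ((p1 ≠ u1 ∧ p1 ≠ r1 ∧ p1 ≠ b1 ∧ u1 ≠ r1 ∧ u1 ≠ b1 ∧ r1 ≠ b1) ∧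
        (q1 ≠ w1 ∧ q1 ≠ r1 ∧ q1 ≠ a1 ∧ w1 ≠ r1 ∧ w1 ≠ a1 ∧ r1 ≠ a1) ∧
        (p1 ≠ n1 ∧ p1 ≠ m1 ∧ p1 ≠ q1 ∧ n1 ≠ m1 ∧ n1 ≠ q1 ∧ m1 ≠ q1) ∧
        (u1 ≠ a1 ∧ u1 ≠ b1 ∧ u1 ≠ w1 ∧ a1 ≠ b1 ∧ a1 ≠ w1 ∧ b1 ≠ w1) ∧ r1 ≠ c1) ∧
      (∀ y, ({p1, y} : Finset (EuclideanSpace ℝ (Fin 3))) ∈ B ↔ (y = a1 ∨ y = u1 ∨ y = c1 ∨ y = n1)) ∧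
      (∀ y, ({q1, y} : Finset (EuclideanSpace ℝ (Fin 3))) ∈ B ↔ (y = b1 ∨ y = w1 ∨ y = c1 ∨ y = m1))))
    (h2 : ((p2 ∈ X ∧ q2 ∈ X ∧ u2 ∈ X ∧ w2 ∈ X ∧ m2 ∈ X ∧ n2 ∈ X ∧ r2 ∈ X) ∧
      (∀ y, ({a2, y} : Finset (EuclideanSpace ℝ (Fin 3))) ∈ B ↔ (y = p2 ∨ y = u2 ∨ y = r2 ∨ y = b2)) ∧
      (∀ y, ({b2, y} : Finset (EuclideanSpace ℝ (Fin 3))) ∈ B ↔ (y = q2 ∨ y = w2 ∨ y = r2 ∨ y = a2)) ∧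
      (∀ y, ({c2, y} : Finset (EuclideanSpace ℝ (Fin 3))) ∈ B ↔ (y = p2 ∨ y = n2 ∨ y = m2 ∨ y = q2)) ∧
      (∀ y, ({r2, y} : Finset (EuclideanSpace ℝ (Fin 3))) ∈ B ↔ (y = u2 ∨ y = a2 ∨ y = b2 ∨ y = w2)) ∧
      (({p2, u2} : Finset (EuclideanSpace ℝ (Fin 3))) ∈ B ∧
        ({u2, r2} : Finset (EuclideanSpace ℝ (Fin 3))) ∈ B ∧
        ({r2, b2} : Finset (EuclideanSpace ℝ (Fin 3))) ∈ B ∧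
        ({q2, w2} : Finset (EuclideanSpace ℝ (Fin 3))) ∈ B ∧
        ({w2, r2} : Finset (EuclideanSpace ℝ (Fin 3))) ∈ B ∧
        ({p2, n2} : Finset (EuclideanSpace ℝ (Fin 3))) ∈ B ∧
        ({n2, m2} : Finset (EuclideanSpace ℝ (Fin 3))) ∈ B ∧
        ({m2, q2} : Finset (EuclideanSpace ℝ (Fin 3))) ∈ B) ∧
      (({p2, r2} : Finset (EuclideanSpace ℝ (Fin 3))) ∉ B ∧
        ({u2, b2} : Finset (EuclideanSpace ℝ (Fin 3))) ∉ B ∧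
        ({p2, b2} : Finset (EuclideanSpace ℝ (Fin 3))) ∉ B ∧
        ({q2, r2} : Finset (EuclideanSpace ℝ (Fin 3))) ∉ B ∧
        ({w2, a2} : Finset (EuclideanSpace ℝ (Fin 3))) ∉ B ∧
        ({q2, a2} : Finset (EuclideanSpace ℝ (Fin 3))) ∉ B ∧
        ({p2, m2} : Finset (EuclideanSpace ℝ (Fin 3))) ∉ B ∧
        ({n2, q2} : Finset (EuclideanSpace ℝ (Fin 3))) ∉ B ∧
        ({p2, q2} : Finset (EuclideanSpace ℝ (Fin 3))) ∉ B ∧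
        ({u2, w2} : Finset (EuclideanSpace ℝ (Fin 3))) ∉ B) ∧
      ((p2 ≠ u2 ∧ p2 ≠ r2 ∧ p2 ≠ b2 ∧ u2 ≠ r2 ∧ u2 ≠ b2 ∧ r2 ≠ b2) ∧
        (q2 ≠ w2 ∧ q2 ≠ r2 ∧ q2 ≠ a2 ∧ w2 ≠ r2 ∧ w2 ≠ a2 ∧ r2 ≠ a2) ∧
        (p2 ≠ n2 ∧ p2 ≠ m2 ∧ p2 ≠ q2 ∧ n2 ≠ m2 ∧ n2 ≠ q2 ∧ m2 ≠ q2) ∧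
        (u2 ≠ a2 ∧ u2 ≠ b2 ∧ u2 ≠ w2 ∧ a2 ≠ b2 ∧ a2 ≠ w2 ∧ b2 ≠ w2) ∧ r2 ≠ c2) ∧
      (∀ y, ({p2, y} : Finset (EuclideanSpace ℝ (Fin 3))) ∈ B ↔ (y = a2 ∨ y = u2 ∨ y = c2 ∨ y = n2)) ∧
      (∀ y, ({q2, y} : Finset (EuclideanSpace ℝ (Fin 3))) ∈ B ↔ (y = b2 ∨ y = w2 ∨ y = c2 ∨ y = m2))))
    (h3 : ((p3 ∈ X ∧ q3 ∈ X ∧ u3 ∈ X ∧ w3 ∈ X ∧ m3 ∈ X ∧ n3 ∈ X ∧ r3 ∈ X) ∧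
      (∀ y, ({a3, y} : Finset (EuclideanSpace ℝ (Fin 3))) ∈ B ↔ (y = p3 ∨ y = u3 ∨ y = r3 ∨ y = b3)) ∧
      (∀ y, ({b3, y} : Finset (EuclideanSpace ℝ (Fin 3))) ∈ B ↔ (y = q3 ∨ y = w3 ∨ y = r3 ∨ y = a3)) ∧
      (∀ y, ({c3, y} : Finset (EuclideanSpace ℝ (Fin 3))) ∈ B ↔ (y = p3 ∨ y = n3 ∨ y = m3 ∨ y = q3)) ∧
      (∀ y, ({r3, y} : Finset (EuclideanSpace ℝ (Fin 3))) ∈ B ↔ (y = u3 ∨ y = a3 ∨ y = b3 ∨ y = w3)) ∧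
      (({p3, u3} : Finset (EuclideanSpace ℝ (Fin 3))) ∈ B ∧
        ({u3, r3} : Finset (EuclideanSpace ℝ (Fin 3))) ∈ B ∧
        ({r3, b3} : Finset (EuclideanSpace ℝ (Fin 3))) ∈ B ∧
        ({q3, w3} : Finset (EuclideanSpace ℝ (Fin 3))) ∈ B ∧
        ({w3, r3} : Finset (EuclideanSpace ℝ (Fin 3))) ∈ B ∧
        ({p3, n3} : Finset (EuclideanSpace ℝ (Fin 3))) ∈ B ∧
        ({n3, m3} : Finset (EuclideanSpace ℝ (Fin 3))) ∈ B ∧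
        ({m3, q3} : Finset (EuclideanSpace ℝ (Fin 3))) ∈ B) ∧
      (({p3, r3} : Finset (EuclideanSpace ℝ (Fin 3))) ∉ B ∧
        ({u3, b3} : Finset (EuclideanSpace ℝ (Fin 3))) ∉ B ∧
        ({p3, b3} : Finset (EuclideanSpace ℝ (Fin 3))) ∉ B ∧
        ({q3, r3} : Finset (EuclideanSpace ℝ (Fin 3))) ∉ B ∧
        ({w3, a3} : Finset (EuclideanSpace ℝ (Fin 3))) ∉ B ∧
        ({q3, a3} : Finset (EuclideanSpace ℝ (Fin 3))) ∉ B ∧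
        ({p3, m3} : Finset (EuclideanSpace ℝ (Fin 3))) ∉ B ∧
        ({n3, q3} : Finset (EuclideanSpace ℝ (Fin 3))) ∉ B ∧
        ({p3, q3} : Finset (EuclideanSpace ℝ (Fin 3))) ∉ B ∧
        ({u3, w3} : Finset (EuclideanSpace ℝ (Fin 3))) ∉ B) ∧
      ((p3 ≠ u3 ∧ p3 ≠ r3 ∧ p3 ≠ b3 ∧ u3 ≠ r3 ∧ u3 ≠ b3 ∧ r3 ≠ b3) ∧
        (q3 ≠ w3 ∧ q3 ≠ r3 ∧ q3 ≠ a3 ∧ w3 ≠ r3 ∧ w3 ≠ a3 ∧ r3 ≠ a3) ∧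
        (p3 ≠ n3 ∧ p3 ≠ m3 ∧ p3 ≠ q3 ∧ n3 ≠ m3 ∧ n3 ≠ q3 ∧ m3 ≠ q3) ∧
        (u3 ≠ a3 ∧ u3 ≠ b3 ∧ u3 ≠ w3 ∧ a3 ≠ b3 ∧ a3 ≠ w3 ∧ b3 ≠ w3) ∧ r3 ≠ c3) ∧
      (∀ y, ({p3, y} : Finset (EuclideanSpace ℝ (Fin 3))) ∈ B ↔ (y = a3 ∨ y = u3 ∨ y = c3 ∨ y = n3)) ∧
      (∀ y, ({q3, y} : Finset (EuclideanSpace ℝ (Fin 3))) ∈ B ↔ (y = b3 ∨ y = w3 ∨ y = c3 ∨ y = m3))))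
    (hac1 : a1 ≠ c1) (hbc1 : b1 ≠ c1) (hac2 : a2 ≠ c2) (hbc2 : b2 ≠ c2) (hac3 : a3 ≠ c3)
    (hbc3 : b3 ≠ c3)
    (hd12 : ∀ y, (y = a1 ∨ y = b1 ∨ y = c1) → ¬ (y = a2 ∨ y = b2 ∨ y = c2))
    (hd13 : ∀ y, (y = a1 ∨ y = b1 ∨ y = c1) → ¬ (y = a3 ∨ y = b3 ∨ y = c3))
    (hd23 : ∀ y, (y = a2 ∨ y = b2 ∨ y = c2) → ¬ (y = a3 ∨ y = b3 ∨ y = c3))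
    {N0 : Finset (EuclideanSpace ℝ (Fin 3))} (hN0X : N0 ⊆ X) (hN0 : N0.card = 3)
    (hp1 : p1 ∈ N0) (hq1 : q1 ∈ N0) (hp2 : p2 ∈ N0) (hq2 : q2 ∈ N0) (hp3 : p3 ∈ N0)
    (hq3 : q3 ∈ N0) (hu1 : u1 ∈ N0) : False := by
  classical
  obtain ⟨⟨hp1X, hq1X, hu1X, hw1X, hm1X, hn1X, hr1X⟩, hNa1, hNb1, hNc1, hNr1,
    ⟨hBpu1, hBur1, hBrb1, hBqw1, hBwr1, hBpn1, hBnm1, hBmq1⟩,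
    ⟨hBpr1, hBub1, hBpb1, hBqr1, hBwa1, hBqa1, hBpm1, hBnq1, hBpq1, hBuw1⟩,
    ⟨⟨hpu1, hpr1, hpb1, hur1, hub1, hrb1⟩, ⟨hqw1, hqr1, hqa1, hwr1, hwa1, hra1⟩,
      ⟨hpn1, hpm1, hpq1, hnm1, hnq1, hmq1⟩, ⟨hua1, hub'1, huw1, hab1, haw1, hbw1⟩, hrc1⟩,
    hNp1, hNq1⟩ := h1
  obtain ⟨⟨hp2X, hq2X, hu2X, hw2X, hm2X, hn2X, hr2X⟩, hNa2, hNb2, hNc2, hNr2,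
    ⟨hBpu2, hBur2, hBrb2, hBqw2, hBwr2, hBpn2, hBnm2, hBmq2⟩,
    ⟨hBpr2, hBub2, hBpb2, hBqr2, hBwa2, hBqa2, hBpm2, hBnq2, hBpq2, hBuw2⟩,
    ⟨⟨hpu2, hpr2, hpb2, hur2, hub2, hrb2⟩, ⟨hqw2, hqr2, hqa2, hwr2, hwa2, hra2⟩,
      ⟨hpn2, hpm2, hpq2, hnm2, hnq2, hmq2⟩, ⟨hua2, hub'2, huw2, hab2, haw2, hbw2⟩, hrc2⟩,
    hNp2, hNq2⟩ := h2
  obtain ⟨⟨hp3X, hq3X, hu3X, hw3X, hm3X, hn3X, hr3X⟩, hNa3, hNb3, hNc3, hNr3,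
    ⟨hBpu3, hBur3, hBrb3, hBqw3, hBwr3, hBpn3, hBnm3, hBmq3⟩,
    ⟨hBpr3, hBub3, hBpb3, hBqr3, hBwa3, hBqa3, hBpm3, hBnq3, hBpq3, hBuw3⟩,
    ⟨⟨hpu3, hpr3, hpb3, hur3, hub3, hrb3⟩, ⟨hqw3, hqr3, hqa3, hwr3, hwa3, hra3⟩,
      ⟨hpn3, hpm3, hpq3, hnm3, hnq3, hmq3⟩, ⟨hua3, hub'3, huw3, hab3, haw3, hbw3⟩, hrc3⟩,
    hNp3, hNq3⟩ := h3
  -- the nine triangle vertices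
  set T9 : Finset (EuclideanSpace ℝ (Fin 3)) := {a1, b1, c1, a2, b2, c2, a3, b3, c3} with hT9
  set r : EuclideanSpace ℝ (Fin 3) → EuclideanSpace ℝ (Fin 3) → Prop :=
    fun z v => ({z, v} : Finset (EuclideanSpace ℝ (Fin 3))) ∈ B with hr
  -- (i) from the `N0` side: at most `4` partners each
  have hle : ∑ z ∈ N0, (T9.filter (r z ·)).card ≤ 12 := by
    have h4 : ∀ z ∈ N0, (T9.filter (r z ·)).card ≤ 4 := by
      intro z hz
      obtain ⟨w, -, -, -, -, honly⟩ := hdeg z (hN0X hz)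
      calc (T9.filter (r z ·)).card ≤ (Finset.univ.image w).card := by
            refine Finset.card_le_card fun v hv => ?_
            obtain ⟨k, hk⟩ := honly v (Finset.mem_filter.1 hv).2
            exact Finset.mem_image.2 ⟨k, Finset.mem_univ _, hk.symm⟩
        _ ≤ 4 := Finset.card_image_le.trans (by simp)
    calc ∑ z ∈ N0, (T9.filter (r z ·)).card ≤ ∑ z ∈ N0, 4 := Finset.sum_le_sum h4
      _ = 12 := by rw [Finset.sum_const, hN0]; rfl
  -- (ii) double counting
  have hdc : ∑ z ∈ N0, (T9.filter (r z ·)).card = ∑ v ∈ T9, (N0.filter (r · v)).card :=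
    Finset.sum_card_bipartiteAbove_eq_sum_card_bipartiteBelow _
  -- (iii) from the triangle side: at least `13`
  have hbond : ∀ {x v : EuclideanSpace ℝ (Fin 3)}, x ∈ N0 →
      ({v, x} : Finset (EuclideanSpace ℝ (Fin 3))) ∈ B → 1 ≤ (N0.filter (r · v)).card := by
    intro x v hx hvx
    refine Finset.card_pos.2 ⟨x, Finset.mem_filter.2 ⟨hx, ?_⟩⟩
    change ({x, v} : Finset (EuclideanSpace ℝ (Fin 3))) ∈ B
    rw [Finset.pair_comm]; exact hvx
  have hbond2 : ∀ {x x' v : EuclideanSpace ℝ (Fin 3)}, x ∈ N0 → x' ∈ N0 → x ≠ x' →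
      ({v, x} : Finset (EuclideanSpace ℝ (Fin 3))) ∈ B →
      ({v, x'} : Finset (EuclideanSpace ℝ (Fin 3))) ∈ B → 2 ≤ (N0.filter (r · v)).card := by
    intro x x' v hx hx' hxx' hvx hvx'
    have hsub : ({x, x'} : Finset (EuclideanSpace ℝ (Fin 3))) ⊆ N0.filter (r · v) := by
      intro y hy
      rw [Finset.mem_insert, Finset.mem_singleton] at hy
      refine Finset.mem_filter.2 ?_
      rcases hy with rfl | rfl
      · refine ⟨hx, ?_⟩
        change ({y, v} : Finset (EuclideanSpace ℝ (Fin 3))) ∈ B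
        rw [Finset.pair_comm]; exact hvx
      · refine ⟨hx', ?_⟩
        change ({y, v} : Finset (EuclideanSpace ℝ (Fin 3))) ∈ B
        rw [Finset.pair_comm]; exact hvx'
    exact (Finset.card_pair hxx').symm.le.trans (Finset.card_le_card hsub)
  have ta1 := hbond2 hp1 hu1 hpu1 ((hNa1 p1).2 (Or.inl rfl)) ((hNa1 u1).2 (Or.inr (Or.inl rfl)))
  have tb1 := hbond hq1 ((hNb1 q1).2 (Or.inl rfl))
  have tc1 := hbond2 hp1 hq1 hpq1 ((hNc1 p1).2 (Or.inl rfl)) ((hNc1 q1).2 (Or.inr (Or.inr (Or.inr rfl))))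
  have ta2 := hbond hp2 ((hNa2 p2).2 (Or.inl rfl))
  have tb2 := hbond hq2 ((hNb2 q2).2 (Or.inl rfl))
  have tc2 := hbond2 hp2 hq2 hpq2 ((hNc2 p2).2 (Or.inl rfl)) ((hNc2 q2).2 (Or.inr (Or.inr (Or.inr rfl))))
  have ta3 := hbond hp3 ((hNa3 p3).2 (Or.inl rfl))
  have tb3 := hbond hq3 ((hNb3 q3).2 (Or.inl rfl))
  have tc3 := hbond2 hp3 hq3 hpq3 ((hNc3 p3).2 (Or.inl rfl)) ((hNc3 q3).2 (Or.inr (Or.inr (Or.inr rfl))))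
  have h1a := hd12 a1 (Or.inl rfl)
  have h1b := hd12 b1 (Or.inr (Or.inl rfl))
  have h1c := hd12 c1 (Or.inr (Or.inr rfl))
  have h1a' := hd13 a1 (Or.inl rfl)
  have h1b' := hd13 b1 (Or.inr (Or.inl rfl))
  have h1c' := hd13 c1 (Or.inr (Or.inr rfl))
  have h2a := hd23 a2 (Or.inl rfl)
  have h2b := hd23 b2 (Or.inr (Or.inl rfl))
  have h2c := hd23 c2 (Or.inr (Or.inr rfl))
  have hge : 13 ≤ ∑ v ∈ T9, (N0.filter (r · v)).card := by
    rw [hT9, Finset.sum_insert, Finset.sum_insert, Finset.sum_insert, Finset.sum_insert,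
      Finset.sum_insert, Finset.sum_insert, Finset.sum_insert, Finset.sum_pair hbc3]
    · omega
    · simp only [Finset.mem_insert, Finset.mem_singleton, not_or]; exact ⟨hab3, hac3⟩
    · simp only [Finset.mem_insert, Finset.mem_singleton, not_or]
      exact ⟨fun h => h2c (Or.inl h), fun h => h2c (Or.inr (Or.inl h)), fun h => h2c (Or.inr (Or.inr h))⟩
    · simp only [Finset.mem_insert, Finset.mem_singleton, not_or]
      exact ⟨hbc2, fun h => h2b (Or.inl h), fun h => h2b (Or.inr (Or.inl h)),
        fun h => h2b (Or.inr (Or.inr h))⟩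
    · simp only [Finset.mem_insert, Finset.mem_singleton, not_or]
      exact ⟨hab2, hac2, fun h => h2a (Or.inl h), fun h => h2a (Or.inr (Or.inl h)),
        fun h => h2a (Or.inr (Or.inr h))⟩
    · simp only [Finset.mem_insert, Finset.mem_singleton, not_or]
      exact ⟨fun h => h1c (Or.inl h), fun h => h1c (Or.inr (Or.inl h)), fun h => h1c (Or.inr (Or.inr h)),
        fun h => h1c' (Or.inl h), fun h => h1c' (Or.inr (Or.inl h)), fun h => h1c' (Or.inr (Or.inr h))⟩
    · simp only [Finset.mem_insert, Finset.mem_singleton, not_or]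
      exact ⟨hbc1, fun h => h1b (Or.inl h), fun h => h1b (Or.inr (Or.inl h)),
        fun h => h1b (Or.inr (Or.inr h)), fun h => h1b' (Or.inl h), fun h => h1b' (Or.inr (Or.inl h)),
        fun h => h1b' (Or.inr (Or.inr h))⟩
    · simp only [Finset.mem_insert, Finset.mem_singleton, not_or]
      exact ⟨hab1, hac1, fun h => h1a (Or.inl h), fun h => h1a (Or.inr (Or.inl h)),
        fun h => h1a (Or.inr (Or.inr h)), fun h => h1a' (Or.inl h), fun h => h1a' (Or.inr (Or.inl h)),
        fun h => h1a' (Or.inr (Or.inr h))⟩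
  omega

include hdeg in
/-- **No three blocks.** -/
theorem no_three_blocks {a1 b1 c1 p1 q1 u1 w1 m1 n1 r1 a2 b2 c2 p2 q2 u2 w2 m2 n2 r2 a3 b3 c3 p3 q3 u3 w3 m3 n3 r3 :
      EuclideanSpace ℝ (Fin 3)}
    (h1 : ((p1 ∈ X ∧ q1 ∈ X ∧ u1 ∈ X ∧ w1 ∈ X ∧ m1 ∈ X ∧ n1 ∈ X ∧ r1 ∈ X) ∧
      (∀ y, ({a1, y} : Finset (EuclideanSpace ℝ (Fin 3))) ∈ B ↔ (y = p1 ∨ y = u1 ∨ y = r1 ∨ y = b1)) ∧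
      (∀ y, ({b1, y} : Finset (EuclideanSpace ℝ (Fin 3))) ∈ B ↔ (y = q1 ∨ y = w1 ∨ y = r1 ∨ y = a1)) ∧
      (∀ y, ({c1, y} : Finset (EuclideanSpace ℝ (Fin 3))) ∈ B ↔ (y = p1 ∨ y = n1 ∨ y = m1 ∨ y = q1)) ∧
      (∀ y, ({r1, y} : Finset (EuclideanSpace ℝ (Fin 3))) ∈ B ↔ (y = u1 ∨ y = a1 ∨ y = b1 ∨ y = w1)) ∧
      (({p1, u1} : Finset (EuclideanSpace ℝ (Fin 3))) ∈ B ∧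
        ({u1, r1} : Finset (EuclideanSpace ℝ (Fin 3))) ∈ B ∧
        ({r1, b1} : Finset (EuclideanSpace ℝ (Fin 3))) ∈ B ∧
        ({q1, w1} : Finset (EuclideanSpace ℝ (Fin 3))) ∈ B ∧
        ({w1, r1} : Finset (EuclideanSpace ℝ (Fin 3))) ∈ B ∧
        ({p1, n1} : Finset (EuclideanSpace ℝ (Fin 3))) ∈ B ∧
        ({n1, m1} : Finset (EuclideanSpace ℝ (Fin 3))) ∈ B ∧
        ({m1, q1} : Finset (EuclideanSpace ℝ (Fin 3))) ∈ B) ∧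
      (({p1, r1} : Finset (EuclideanSpace ℝ (Fin 3))) ∉ B ∧
        ({u1, b1} : Finset (EuclideanSpace ℝ (Fin 3))) ∉ B ∧
        ({p1, b1} : Finset (EuclideanSpace ℝ (Fin 3))) ∉ B ∧
        ({q1, r1} : Finset (EuclideanSpace ℝ (Fin 3))) ∉ B ∧
        ({w1, a1} : Finset (EuclideanSpace ℝ (Fin 3))) ∉ B ∧
        ({q1, a1} : Finset (EuclideanSpace ℝ (Fin 3))) ∉ B ∧
        ({p1, m1} : Finset (EuclideanSpace ℝ (Fin 3))) ∉ B ∧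
        ({n1, q1} : Finset (EuclideanSpace ℝ (Fin 3))) ∉ B ∧
        ({p1, q1} : Finset (EuclideanSpace ℝ (Fin 3))) ∉ B ∧
        ({u1, w1} : Finset (EuclideanSpace ℝ (Fin 3))) ∉ B) ∧
      ((p1 ≠ u1 ∧ p1 ≠ r1 ∧ p1 ≠ b1 ∧ u1 ≠ r1 ∧ u1 ≠ b1 ∧ r1 ≠ b1) ∧
        (q1 ≠ w1 ∧ q1 ≠ r1 ∧ q1 ≠ a1 ∧ w1 ≠ r1 ∧ w1 ≠ a1 ∧ r1 ≠ a1) ∧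
        (p1 ≠ n1 ∧ p1 ≠ m1 ∧ p1 ≠ q1 ∧ n1 ≠ m1 ∧ n1 ≠ q1 ∧ m1 ≠ q1) ∧
        (u1 ≠ a1 ∧ u1 ≠ b1 ∧ u1 ≠ w1 ∧ a1 ≠ b1 ∧ a1 ≠ w1 ∧ b1 ≠ w1) ∧ r1 ≠ c1) ∧
      (∀ y, ({p1, y} : Finset (EuclideanSpace ℝ (Fin 3))) ∈ B ↔ (y = a1 ∨ y = u1 ∨ y = c1 ∨ y = n1)) ∧
      (∀ y, ({q1, y} : Finset (EuclideanSpace ℝ (Fin 3))) ∈ B ↔ (y = b1 ∨ y = w1 ∨ y = c1 ∨ y = m1))))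
    (h2 : ((p2 ∈ X ∧ q2 ∈ X ∧ u2 ∈ X ∧ w2 ∈ X ∧ m2 ∈ X ∧ n2 ∈ X ∧ r2 ∈ X) ∧
      (∀ y, ({a2, y} : Finset (EuclideanSpace ℝ (Fin 3))) ∈ B ↔ (y = p2 ∨ y = u2 ∨ y = r2 ∨ y = b2)) ∧
      (∀ y, ({b2, y} : Finset (EuclideanSpace ℝ (Fin 3))) ∈ B ↔ (y = q2 ∨ y = w2 ∨ y = r2 ∨ y = a2)) ∧
      (∀ y, ({c2, y} : Finset (EuclideanSpace ℝ (Fin 3))) ∈ B ↔ (y = p2 ∨ y = n2 ∨ y = m2 ∨ y = q2)) ∧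
      (∀ y, ({r2, y} : Finset (EuclideanSpace ℝ (Fin 3))) ∈ B ↔ (y = u2 ∨ y = a2 ∨ y = b2 ∨ y = w2)) ∧
      (({p2, u2} : Finset (EuclideanSpace ℝ (Fin 3))) ∈ B ∧
        ({u2, r2} : Finset (EuclideanSpace ℝ (Fin 3))) ∈ B ∧
        ({r2, b2} : Finset (EuclideanSpace ℝ (Fin 3))) ∈ B ∧
        ({q2, w2} : Finset (EuclideanSpace ℝ (Fin 3))) ∈ B ∧
        ({w2, r2} : Finset (EuclideanSpace ℝ (Fin 3))) ∈ B ∧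
        ({p2, n2} : Finset (EuclideanSpace ℝ (Fin 3))) ∈ B ∧
        ({n2, m2} : Finset (EuclideanSpace ℝ (Fin 3))) ∈ B ∧
        ({m2, q2} : Finset (EuclideanSpace ℝ (Fin 3))) ∈ B) ∧
      (({p2, r2} : Finset (EuclideanSpace ℝ (Fin 3))) ∉ B ∧
        ({u2, b2} : Finset (EuclideanSpace ℝ (Fin 3))) ∉ B ∧
        ({p2, b2} : Finset (EuclideanSpace ℝ (Fin 3))) ∉ B ∧
        ({q2, r2} : Finset (EuclideanSpace ℝ (Fin 3))) ∉ B ∧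
        ({w2, a2} : Finset (EuclideanSpace ℝ (Fin 3))) ∉ B ∧
        ({q2, a2} : Finset (EuclideanSpace ℝ (Fin 3))) ∉ B ∧
        ({p2, m2} : Finset (EuclideanSpace ℝ (Fin 3))) ∉ B ∧
        ({n2, q2} : Finset (EuclideanSpace ℝ (Fin 3))) ∉ B ∧
        ({p2, q2} : Finset (EuclideanSpace ℝ (Fin 3))) ∉ B ∧
        ({u2, w2} : Finset (EuclideanSpace ℝ (Fin 3))) ∉ B) ∧
      ((p2 ≠ u2 ∧ p2 ≠ r2 ∧ p2 ≠ b2 ∧ u2 ≠ r2 ∧ u2 ≠ b2 ∧ r2 ≠ b2) ∧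
        (q2 ≠ w2 ∧ q2 ≠ r2 ∧ q2 ≠ a2 ∧ w2 ≠ r2 ∧ w2 ≠ a2 ∧ r2 ≠ a2) ∧
        (p2 ≠ n2 ∧ p2 ≠ m2 ∧ p2 ≠ q2 ∧ n2 ≠ m2 ∧ n2 ≠ q2 ∧ m2 ≠ q2) ∧
        (u2 ≠ a2 ∧ u2 ≠ b2 ∧ u2 ≠ w2 ∧ a2 ≠ b2 ∧ a2 ≠ w2 ∧ b2 ≠ w2) ∧ r2 ≠ c2) ∧
      (∀ y, ({p2, y} : Finset (EuclideanSpace ℝ (Fin 3))) ∈ B ↔ (y = a2 ∨ y = u2 ∨ y = c2 ∨ y = n2)) ∧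
      (∀ y, ({q2, y} : Finset (EuclideanSpace ℝ (Fin 3))) ∈ B ↔ (y = b2 ∨ y = w2 ∨ y = c2 ∨ y = m2))))
    (h3 : ((p3 ∈ X ∧ q3 ∈ X ∧ u3 ∈ X ∧ w3 ∈ X ∧ m3 ∈ X ∧ n3 ∈ X ∧ r3 ∈ X) ∧
      (∀ y, ({a3, y} : Finset (EuclideanSpace ℝ (Fin 3))) ∈ B ↔ (y = p3 ∨ y = u3 ∨ y = r3 ∨ y = b3)) ∧
      (∀ y, ({b3, y} : Finset (EuclideanSpace ℝ (Fin 3))) ∈ B ↔ (y = q3 ∨ y = w3 ∨ y = r3 ∨ y = a3)) ∧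
      (∀ y, ({c3, y} : Finset (EuclideanSpace ℝ (Fin 3))) ∈ B ↔ (y = p3 ∨ y = n3 ∨ y = m3 ∨ y = q3)) ∧
      (∀ y, ({r3, y} : Finset (EuclideanSpace ℝ (Fin 3))) ∈ B ↔ (y = u3 ∨ y = a3 ∨ y = b3 ∨ y = w3)) ∧
      (({p3, u3} : Finset (EuclideanSpace ℝ (Fin 3))) ∈ B ∧
        ({u3, r3} : Finset (EuclideanSpace ℝ (Fin 3))) ∈ B ∧
        ({r3, b3} : Finset (EuclideanSpace ℝ (Fin 3))) ∈ B ∧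
        ({q3, w3} : Finset (EuclideanSpace ℝ (Fin 3))) ∈ B ∧
        ({w3, r3} : Finset (EuclideanSpace ℝ (Fin 3))) ∈ B ∧
        ({p3, n3} : Finset (EuclideanSpace ℝ (Fin 3))) ∈ B ∧
        ({n3, m3} : Finset (EuclideanSpace ℝ (Fin 3))) ∈ B ∧
        ({m3, q3} : Finset (EuclideanSpace ℝ (Fin 3))) ∈ B) ∧
      (({p3, r3} : Finset (EuclideanSpace ℝ (Fin 3))) ∉ B ∧
        ({u3, b3} : Finset (EuclideanSpace ℝ (Fin 3))) ∉ B ∧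
        ({p3, b3} : Finset (EuclideanSpace ℝ (Fin 3))) ∉ B ∧
        ({q3, r3} : Finset (EuclideanSpace ℝ (Fin 3))) ∉ B ∧
        ({w3, a3} : Finset (EuclideanSpace ℝ (Fin 3))) ∉ B ∧
        ({q3, a3} : Finset (EuclideanSpace ℝ (Fin 3))) ∉ B ∧
        ({p3, m3} : Finset (EuclideanSpace ℝ (Fin 3))) ∉ B ∧
        ({n3, q3} : Finset (EuclideanSpace ℝ (Fin 3))) ∉ B ∧
        ({p3, q3} : Finset (EuclideanSpace ℝ (Fin 3))) ∉ B ∧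
        ({u3, w3} : Finset (EuclideanSpace ℝ (Fin 3))) ∉ B) ∧
      ((p3 ≠ u3 ∧ p3 ≠ r3 ∧ p3 ≠ b3 ∧ u3 ≠ r3 ∧ u3 ≠ b3 ∧ r3 ≠ b3) ∧
        (q3 ≠ w3 ∧ q3 ≠ r3 ∧ q3 ≠ a3 ∧ w3 ≠ r3 ∧ w3 ≠ a3 ∧ r3 ≠ a3) ∧
        (p3 ≠ n3 ∧ p3 ≠ m3 ∧ p3 ≠ q3 ∧ n3 ≠ m3 ∧ n3 ≠ q3 ∧ m3 ≠ q3) ∧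
        (u3 ≠ a3 ∧ u3 ≠ b3 ∧ u3 ≠ w3 ∧ a3 ≠ b3 ∧ a3 ≠ w3 ∧ b3 ≠ w3) ∧ r3 ≠ c3) ∧
      (∀ y, ({p3, y} : Finset (EuclideanSpace ℝ (Fin 3))) ∈ B ↔ (y = a3 ∨ y = u3 ∨ y = c3 ∨ y = n3)) ∧
      (∀ y, ({q3, y} : Finset (EuclideanSpace ℝ (Fin 3))) ∈ B ↔ (y = b3 ∨ y = w3 ∨ y = c3 ∨ y = m3))))
    (hac1 : a1 ≠ c1) (hbc1 : b1 ≠ c1) (hac2 : a2 ≠ c2) (hbc2 : b2 ≠ c2) (hac3 : a3 ≠ c3)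
    (hbc3 : b3 ≠ c3)
    (hd12 : ∀ y, (y = a1 ∨ y = b1 ∨ y = c1) → ¬ (y = a2 ∨ y = b2 ∨ y = c2))
    (hd13 : ∀ y, (y = a1 ∨ y = b1 ∨ y = c1) → ¬ (y = a3 ∨ y = b3 ∨ y = c3))
    (hd23 : ∀ y, (y = a2 ∨ y = b2 ∨ y = c2) → ¬ (y = a3 ∨ y = b3 ∨ y = c3))
    {N0 : Finset (EuclideanSpace ℝ (Fin 3))} (hN0X : N0 ⊆ X) (hN0 : N0.card = 3)
    (hp1 : p1 ∈ N0) (hq1 : q1 ∈ N0) (hp2 : p2 ∈ N0) (hq2 : q2 ∈ N0) (hp3 : p3 ∈ N0)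
    (hq3 : q3 ∈ N0)
    (ha1 : a1 ∉ N0) (hb1 : b1 ∉ N0) (hr1 : r1 ∉ N0)
    (hV : ∀ y ∈ X, y ∉ N0 → (y = a1 ∨ y = b1 ∨ y = c1) ∨ (y = a2 ∨ y = b2 ∨ y = c2) ∨
      (y = a3 ∨ y = b3 ∨ y = c3)) : False := by
  have hu1 : u1 ∉ N0 := fun h => three_blocks_u hdeg h1 h2 h3 hac1 hbc1 hac2 hbc2 hac3 hbc3 hd12 hd13
    hd23 hN0X hN0 hp1 hq1 hp2 hq2 hp3 hq3 h
  have hw1 : w1 ∉ N0 := fun h => three_blocks_u hdeg (block_swap h1) h2 h3 hbc1 hac1 hac2 hbc2 hac3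
    hbc3 (fun y hy => hd12 y (by rcases hy with h | h | h; exacts [Or.inr (Or.inl h), Or.inl h, Or.inr (Or.inr h)]))
    (fun y hy => hd13 y (by rcases hy with h | h | h; exacts [Or.inr (Or.inl h), Or.inl h, Or.inr (Or.inr h)]))
    hd23 hN0X hN0 hq1 hp1 hp2 hq2 hp3 hq3 h
  obtain ⟨⟨hp1X, hq1X, hu1X, hw1X, hm1X, hn1X, hr1X⟩, hNa1, hNb1, hNc1, hNr1,
    ⟨hBpu1, hBur1, hBrb1, hBqw1, hBwr1, hBpn1, hBnm1, hBmq1⟩,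
    ⟨hBpr1, hBub1, hBpb1, hBqr1, hBwa1, hBqa1, hBpm1, hBnq1, hBpq1, hBuw1⟩,
    ⟨⟨hpu1, hpr1, hpb1, hur1, hub1, hrb1⟩, ⟨hqw1, hqr1, hqa1, hwr1, hwa1, hra1⟩,
      ⟨hpn1, hpm1, hpq1, hnm1, hnq1, hmq1⟩, ⟨hua1, hub'1, huw1, hab1, haw1, hbw1⟩, hrc1⟩,
    hNp1, hNq1⟩ := h1
  obtain ⟨-, hNa2, hNb2, hNc2, -⟩ := h2
  obtain ⟨-, hNa3, hNb3, hNc3, -⟩ := h3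
  -- every partner of `r₁` is outside `N0`
  have hNr1' : ∀ y, ({r1, y} : Finset (EuclideanSpace ℝ (Fin 3))) ∈ B → y ∉ N0 := by
    intro y hy
    rcases (hNr1 y).1 hy with rfl | rfl | rfl | rfl
    exacts [hu1, ha1, hb1, hw1]
  rcases hV r1 hr1X hr1 with (e | e | e) | (e | e | e) | (e | e | e)
  · exact hra1 e
  · exact hrb1 e
  · exact hrc1 e
  · exact hNr1' p2 (e ▸ (hNa2 p2).2 (Or.inl rfl)) hp2
  · exact hNr1' q2 (e ▸ (hNb2 q2).2 (Or.inl rfl)) hq2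
  · exact hNr1' p2 (e ▸ (hNc2 p2).2 (Or.inl rfl)) hp2
  · exact hNr1' p3 (e ▸ (hNa3 p3).2 (Or.inl rfl)) hp3
  · exact hNr1' q3 (e ▸ (hNb3 q3).2 (Or.inl rfl)) hq3
  · exact hNr1' p3 (e ▸ (hNc3 p3).2 (Or.inl rfl)) hp3

end Setting

end Summit.AtomisticToContinuum.Crystallization.Theorems
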